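import Summits.NavierStokesRegularity.NavierStokesRegularity.Theses.FilamentSkeletonRss

/-!
# Ideator-2 sketch — crux `CoreGluingGivenInvertibilityQ` (stmt-18689 → successor stmt-19176), round 1

First-lemma signatures (Props over existing declarations; nothing here needs a proof for the
protocol, two sanity lemmas are proved) for the crux idea cards

* `frame-pump-sonic-trap`      — `SectionalVirial`, `ThinCoreBound`, `AxisHeadIdentity`,
                                  `HydraulicLaw`, `DiscriminantMonotone`;
* `tilted-core-rotation-shift` — `angDeriv`, `AmbientRotationSkew`, `AngularCommutesL`,
                                  `CoreLinearInvertibilityTilted`.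
-/

set_option linter.dupNamespace false

namespace Summit.NavierStokesRegularity.NavierStokesRegularity.Cruxes.CoreGluingGivenInvertibilityQ.Ideator2

open MeasureTheory
open scoped Laplacian InnerProductSpace RealInnerProductSpace
open Literature.Analysis.FluidPDE

local notation "ℝ²" => EuclideanSpace ℝ (Fin 2)
local notation "ℝ³" => EuclideanSpace ℝ (Fin 3)

/-! ## Card `frame-pump-sonic-trap` -/

/-- **E1 · sectional virial identity** (planar seed, GW/GM normalisation of the tree). For every
classical steady strained vortex `v·∇w = L_λ w` (`IsClassicalAsymBurgersVortex lam α w`) with rapid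
decay of `w, ∇w, Δw`:  `∫ ((1+λ) x₀² + (1−λ) x₁²) w = 4 α`.
Proof sketch: pair the equation with `|x|²`; `∫|x|²Δw = 4α`, the drift gives
`−∫((2+λ)x₀² + (2−λ)x₁²) w`, the `+w` term gives `+∫|x|² w`, and the self-induction term vanishes,
`∫ |x|² (K∗w)·∇w = −2∫ (x·(K∗w)) w = 0` by antisymmetry of `x·K(x−y)` (Fubini). -/
def SectionalVirial : Prop :=
  ∀ (lam α : ℝ) (w : ℝ² → ℝ), IsClassicalAsymBurgersVortex lam α w →
    (∀ k : ℕ, ∃ C : ℝ, ∀ x, ‖x‖ ^ k * (|w x| + ‖gradient w x‖ + |(Δ w) x|) ≤ C) →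
    ∫ x, ((1 + lam) * x 0 ^ 2 + (1 - lam) * x 1 ^ 2) * w x = 4 * α

/-- **E1′ · thin-core bound** (corollary for one-signed vorticity, `λ ∈ [0,1)`): the second moment
of ANY steady state is `≤ 4α/(1−λ)` in core units — no fat steady core at a confined stagnation
point, for every circulation `α` (uses supercriticality: the core length unit is
`(w′(c) − 3/2)^{-1/2}`, cf. `cruxAt_iff_of_lt_half`). -/
def ThinCoreBound : Prop :=
  ∀ (lam α : ℝ) (w : ℝ² → ℝ), lam ∈ Set.Ico (0 : ℝ) 1 → IsClassicalAsymBurgersVortex lam α w →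
    (∀ x, 0 ≤ w x) →
    (∀ k : ℕ, ∃ C : ℝ, ∀ x, ‖x‖ ^ k * (|w x| + ‖gradient w x‖ + |(Δ w) x|) ≤ C) →
    (1 - lam) * ∫ x, ‖x‖ ^ 2 * w x ≤ 4 * α

/-- The frame velocity `W = U + ½ y − α e₃ × y` of the rotated Leray profile equation of
`TransverseReduction(R)`. -/
noncomputable def frameVel (α : ℝ) (U : ℝ³ → ℝ³) (y : ℝ³) : ℝ³ :=
  U y + (1/2 : ℝ) • y - α • cross (EuclideanSpace.single 2 1) y

/-- The rotating-frame head `H_α = ½|W|² + P − |y|²/8 − ½ α² |y_h|²`. -/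
noncomputable def frameHead (α : ℝ) (U : ℝ³ → ℝ³) (P : ℝ³ → ℝ) (y : ℝ³) : ℝ :=
  (1/2 : ℝ) * ‖frameVel α U y‖ ^ 2 + P y - ‖y‖ ^ 2 / 8 - (1/2 : ℝ) * α ^ 2 * (y 0 ^ 2 + y 1 ^ 2)

/-- **E2 · axis head identity (exact Bernoulli law of the profile equation).** If `(U, P)` solve the
forced rotated Leray profile equation of `TransverseReductionR`,
`α(e₃×U − DU[e₃×y]) + ½U + ½DU[y] − ΔU + DU[U] + ∇P = F`, then with `W = frameVel α U` the equation
is `W·∇W + 2α e₃×W + ∇(P − |y|²/8 − ½α²|y_h|²) = ΔU + F`, hence POINTWISE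
`⟪W, ∇H_α⟫ = ⟪W, ΔU + F⟫` (the Coriolis force does no work). On a core axis `W` is axial and the
accretion forcing `F = Σ B_j D_j` is azimuthal, so the head is transported exactly up to viscosity. -/
def AxisHeadIdentity : Prop :=
  ∀ (α : ℝ) (U F : ℝ³ → ℝ³) (P : ℝ³ → ℝ), ContDiff ℝ 2 U → ContDiff ℝ 1 P →
    (∀ y, α • (cross (EuclideanSpace.single 2 1) (U y) - fderiv ℝ U y (cross (EuclideanSpace.single 2 1) y))
        + (1/2 : ℝ) • U y + (1/2 : ℝ) • fderiv ℝ U y y - (Δ U) y + fderiv ℝ U y (U y) + gradient P y = F y) →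
    ∀ y, ⟪frameVel α U y, gradient (frameHead α U P) y⟫_ℝ = ⟪frameVel α U y, (Δ U) y + F y⟫_ℝ

/-- **E3/E4 · the quasi-one-dimensional hydraulic law of a steady slender core end** (pointwise
algebra). Along arclength `τ` of a steady slender Gaussian core of circulation `κ = Γγ_j` let `V` be
the axis velocity, `A = a²` the similarity core area, `w` the ambient (skeleton + frame) tangential
velocity and `Cκ2 = C κ²` the cyclostrophic constant. The volume/vorticity budget
`(A V)′ = (3/2) A + 4` (frame volume source `div(½y) = 3/2`, viscous area gain `4`) and the axis head
law `C κ² (1/A)′ = V V′ − w w′` (E2 minus the ambient streamline) give the ONE-LINE hydraulic law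
`(c₀² − V²) V′ = c₀² (3/2 + 4/A) − V w w′`, `c₀² = Cκ²/A` — sonic denominator, and a numerator that is
POSITIVE wherever `V w w′ < c₀² (3/2 + 4/A)` (in particular wherever `w′ ≤ 3/2` and `V,w ≤ c₀`). -/
def HydraulicLaw : Prop :=
  ∀ (Cκ2 : ℝ) (V A w : ℝ → ℝ) (τ : ℝ), DifferentiableAt ℝ V τ → DifferentiableAt ℝ A τ →
    DifferentiableAt ℝ w τ → A τ ≠ 0 → V τ ≠ 0 →
    deriv (fun s => A s * V s) τ = 3/2 * A τ + 4 →
    Cκ2 * deriv (fun s => (A s)⁻¹) τ = V τ * deriv V τ - w τ * deriv w τ →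
    (Cκ2 / A τ - V τ ^ 2) * deriv V τ = Cκ2 / A τ * (3/2 + 4 / A τ) - V τ * (w τ * deriv w τ)

/-- **E3 · monotone discriminant**: under the axis head law alone, `(V² − c₀²)′ = V V′ + w w′`; so on
an end where `V, V′, w, w′ ≥ 0` the flow crosses from sub- to supercritical at most once and DOES
cross once `½(V² + w²)` exceeds `c₀(c)² = Cκ²/A(c)`. -/
def DiscriminantMonotone : Prop :=
  ∀ (Cκ2 : ℝ) (V A w : ℝ → ℝ) (τ : ℝ), DifferentiableAt ℝ V τ → DifferentiableAt ℝ A τ →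
    DifferentiableAt ℝ w τ → A τ ≠ 0 →
    Cκ2 * deriv (fun s => (A s)⁻¹) τ = V τ * deriv V τ - w τ * deriv w τ →
    deriv (fun s => V s ^ 2 - Cκ2 / A s) τ = V τ * deriv V τ + w τ * deriv w τ

/-- Sanity: the discriminant identity is two lines of calculus (so E3 is not where the line can fail). -/
theorem discriminantMonotone_holds : DiscriminantMonotone := by
  intro Cκ2 V A w τ hV hA hw hA0 hB
  have hVsq : DifferentiableAt ℝ (fun s => V s ^ 2) τ := hV.pow 2
  have hAinv : DifferentiableAt ℝ (fun s => (A s)⁻¹) τ := hA.inv hA0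
  have hCA : DifferentiableAt ℝ (fun s => Cκ2 * (A s)⁻¹) τ := hAinv.const_mul Cκ2
  have e : (fun s => V s ^ 2 - Cκ2 / A s) = (fun s => V s ^ 2) - (fun s => Cκ2 * (A s)⁻¹) := by
    funext s; simp [div_eq_mul_inv]
  have h2 : deriv (fun s => V s ^ 2) τ = 2 * V τ * deriv V τ := by
    have h := (hV.hasDerivAt.pow 2).deriv
    have e2 : (fun s => V s ^ 2) = V ^ 2 := by funext s; simp
    rw [e2, h]; norm_num
  have h3 : deriv (fun s => Cκ2 * (A s)⁻¹) τ = Cκ2 * deriv (fun s => (A s)⁻¹) τ :=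
    deriv_const_mul Cκ2 hAinv
  rw [e, deriv_sub hVsq hCA, h2, h3, hB]; ring

/-! ## Card `tilted-core-rotation-shift` -/

/-- The angular derivative `∂_θ = x₀ ∂₁ − x₁ ∂₀` (generator of rotations of the plane). -/
noncomputable def angDeriv (w : ℝ² → ℝ) (x : ℝ²) : ℝ :=
  x 0 * fderiv ℝ w x (EuclideanSpace.single 1 1) - x 1 * fderiv ℝ w x (EuclideanSpace.single 0 1)

/-- **B1 · ambient rotation is exactly skew in `X_λ`.** The weight `G_λ = gaussWeightLam λ` of
`CoreLinearInvertibility` is RADIAL, so `∫ G_λ⁻¹ w ∂_θ w = 0` for every `C¹` vorticity with the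
weighted norms finite: the tilt term `−ω ∂_θ` of the planar operator at a tilted core
(`AmbientRotationTilt`, p167617) is invisible in every `X_λ` energy identity. -/
def AmbientRotationSkew : Prop :=
  ∀ (lam : ℝ) (w : ℝ² → ℝ), lam < 1 → ContDiff ℝ 1 w →
    Integrable (fun x => (gaussWeightLam lam x)⁻¹ * w x ^ 2) →
    Integrable (fun x => (gaussWeightLam lam x)⁻¹ * (‖x‖ * (|w x| * ‖gradient w x‖))) →
    ∫ x, (gaussWeightLam lam x)⁻¹ * (w x * angDeriv w x) = 0

/-- **B2 · `∂_θ` commutes with the symmetric part `L = L₀`** of the strained operator (and with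
`Λ_G`, both rotation invariant); only the strain `M = ½(x₀∂₀ − x₁∂₁)` fails: `[∂_θ, M] = −2M′`,
`M′ = ½(x₀∂₁ + x₁∂₀)`. Stated for `L₀ = strainedVorticityOperator 0` on `C³` functions. -/
def AngularCommutesL : Prop :=
  ∀ (w : ℝ² → ℝ), ContDiff ℝ 3 w → ∀ x,
    angDeriv (strainedVorticityOperator 0 w) x = strainedVorticityOperator 0 (angDeriv w) x

/-- **B3 · the tilted-core invertibility the gluing actually needs** (conjectural extension of the
PROVED `CoreLinearInvertibility`, p. `coreLinearInvertibility_proof`): the same a-priori bound for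
`T_{λ,R} − ω ∂_θ`, uniformly for `|ω| ≤ ω₀`, every `ω₀`. Mechanism: per angular mode `n` the tilt is
the shift `Ω(r) ↦ Ω(r) + ω/R` of the LOCAL rotation in `Λ_G = Ω∂_θ(1 + ΦΔ⁻¹)`; parity is preserved;
at `λ = 0` it holds with `c = 1` for all `ω, R` by B1 (energy identity). -/
def CoreLinearInvertibilityTilted : Prop :=
  ∀ lam ∈ Set.Ico (0 : ℝ) 1, ∀ ω₀ : ℝ, ∃ R₀ c : ℝ, 0 < c ∧ ∀ R ω : ℝ, R₀ ≤ R → |ω| ≤ ω₀ →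
    ∀ w : ℝ² → ℝ, ContDiff ℝ 2 w →
    Integrable (fun x => (gaussWeightLam lam x)⁻¹ * w x ^ 2) →
    (∀ x, Integrable (fun y => w y • biotSavartKernel2D (x - y))) →
    Integrable (fun x => (gaussWeightLam lam x)⁻¹ *
      (strainedVorticityOperator lam w x - ω * angDeriv w x
        - R * (⟪gaussVortexVelocity x, gradient w x⟫_ℝ + ⟪biotSavart2D w x, gradient gaussVortexProfile x⟫_ℝ)) ^ 2) →
    ∫ x, w x = 0 → ∫ x, x 0 * w x = 0 → ∫ x, x 1 * w x = 0 →
    c ^ 2 * ∫ x, (gaussWeightLam lam x)⁻¹ * w x ^ 2 ≤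
      ∫ x, (gaussWeightLam lam x)⁻¹ *
        (strainedVorticityOperator lam w x - ω * angDeriv w x
          - R * (⟪gaussVortexVelocity x, gradient w x⟫_ℝ + ⟪biotSavart2D w x, gradient gaussVortexProfile x⟫_ℝ)) ^ 2

/-- Sanity: the tilted statement at `ω₀ = 0`-slice is implied by the proved crux (so B3 is a genuine
EXTENSION of a theorem, not a restatement of an open item). -/
theorem tilted_at_zero_of_cli
    (h : Summit.NavierStokesRegularity.NavierStokesRegularity.Theses.FilamentSkeletonRss.CoreLinearInvertibility)
    (lam : ℝ) (hlam : lam ∈ Set.Ico (0 : ℝ) 1) :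
    ∃ R₀ c : ℝ, 0 < c ∧ ∀ R : ℝ, R₀ ≤ R →
    ∀ w : ℝ² → ℝ, ContDiff ℝ 2 w →
    Integrable (fun x => (gaussWeightLam lam x)⁻¹ * w x ^ 2) →
    (∀ x, Integrable (fun y => w y • biotSavartKernel2D (x - y))) →
    Integrable (fun x => (gaussWeightLam lam x)⁻¹ *
      (strainedVorticityOperator lam w x - 0 * angDeriv w x
        - R * (⟪gaussVortexVelocity x, gradient w x⟫_ℝ + ⟪biotSavart2D w x, gradient gaussVortexProfile x⟫_ℝ)) ^ 2) →
    ∫ x, w x = 0 → ∫ x, x 0 * w x = 0 → ∫ x, x 1 * w x = 0 →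
    c ^ 2 * ∫ x, (gaussWeightLam lam x)⁻¹ * w x ^ 2 ≤
      ∫ x, (gaussWeightLam lam x)⁻¹ *
        (strainedVorticityOperator lam w x - 0 * angDeriv w x
          - R * (⟪gaussVortexVelocity x, gradient w x⟫_ℝ + ⟪biotSavart2D w x, gradient gaussVortexProfile x⟫_ℝ)) ^ 2 := by
  obtain ⟨R₀, c, hc, hR⟩ := h lam hlam
  refine ⟨R₀, c, hc, fun R hRR w hw hi hk hT h0 h1 h2 => ?_⟩
  simpa using hR R hRR w hw hi hk (by simpa using hT) h0 h1 h2

end Summit.NavierStokesRegularity.NavierStokesRegularity.Cruxes.CoreGluingGivenInvertibilityQ.Ideator2
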